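import Mathlib.NumberTheory.NumberField.InfinitePlace.Embeddings
import Mathlib.NumberTheory.NumberField.Basic
import Mathlib.RingTheory.IntegralClosure.IsIntegralClosure.Basic
import Mathlib.Logic.Equiv.Defs
import HarnessLib

/-!
# [IUTchIII] Proposition 3.10: global Kummer theory and non-interference with local integers;
# Remarks 3.10.1, 3.10.2 (abc-iut cell, layer L6, slice [IUTchIII] §3)

S. Mochizuki, *Inter-universal Teichmüller theory III*, kurims manuscript (May 2020) of PRIMS
**57** (2021), §3: Proposition 3.10 "(Global Kummer Theory and Non-interference with Local
Integers)" pp. 147–149, Remark 3.10.1 pp. 149–151 (with Fig. 3.2), Remark 3.10.2 pp. 151–152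
(PRIMS offset ≈ +420). STATEMENTS-FIRST typing:

* (i) and (iii) are CONSTRUCTIONS ("functorial algorithms … for constructing [number] fields,
  monoids, and Frobenioids equipped with natural isomorphisms … Kummer isomorphisms") inside a
  column of the LGP-Gaussian log-theta-lattice; their inputs belong to [IUTchII] Cor. 4.7, 4.8
  (abc-iut-L6-t2) and Proposition 3.7 / Definition 3.8 (`ThetaPilotObjects.lean`). Typed as OUTPUT
  SIGNATURES over abstract types (`VerticallyCoricGlobalData`, `Prop310iii_compatible`).
* (ii) "Non-interference with Local Integers": `(†𝕄⊛_MOD)_α ∩ Π_{v∈𝕍} Ψ_{log(^{A,α}𝓕_v)} = (†𝕄⊛μ_MOD)_α`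
  (the roots of unity). Its mathematical content is, in the words of the printed proof (p. 149),
  "the well-known fact that the set of nonzero elements of a number field that are integral at all
  of the places of the number field consists of the set of roots of unity [cf. [Lang], p. 144, the
  proof of Theorem 5]" — PROVED here from Mathlib's Kronecker theorem
  (`NumberField.Embeddings.pow_eq_one_of_norm_le_one`): `integralAtAllPlaces_iff_rootOfUnity`.
  The set-theoretic identity itself is then typed over the interface (`Prop310ii_nonInterference`)
  and PROVED from that fact under the interface axiom identifying "`x ∈ Ψ` at every `v ∈ 𝕍`" with
  integrality at all places (𝕍 → 𝕍_mod is a bijection, [IUTchI] Def. 3.1 (e)).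
* Remark 3.10.1 (i)–(iv) typed as indicated; Remark 3.10.2 (the `2 × 4` commutative diagram of
  `𝓕^{⊩▶×μ}`-prime-strips: "each of these lower horizontal arrows may be constructed by conjugating the
  corresponding upper horizontal arrow by the relevant Kummer isomorphisms") PROVED as the formal
  statement about conjugating equivalences.
Tag form [claim: Mochizuki2012, status: disputed] (D-0012 claim key).
-/

namespace Literature.IUT.LogThetaLattice

universe u v w

/-! ### Proposition 3.10 (ii): the classical fact and the non-interference identity -/

section NonInterference

open NumberField

variable (K : Type u) [Field K] [NumberField K]

/-- An element of a number field is **integral at all places** ([IUTchIII] proof of Proposition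
3.10, p. 149; [Lang] p. 144): integral at the nonarchimedean places — equivalently an algebraic
integer, `IsIntegral ℤ x` — and of absolute value `≤ 1` at every archimedean place (every complex
embedding). [claim: Mochizuki2012, status: disputed] -/
def IsIntegralAtAllPlaces (x : K) : Prop :=
  IsIntegral ℤ x ∧ ∀ φ : K →+* ℂ, ‖φ x‖ ≤ 1

/-- **"The set of nonzero elements of a number field that are integral at all of the places of the
number field consists of the set of roots of unity"** ([IUTchIII] proof of Proposition 3.10,
p. 149, citing [Lang] p. 144, proof of Theorem 5) — PROVED (Kronecker's theorem, Mathlib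
`NumberField.Embeddings.pow_eq_one_of_norm_le_one`, and conversely roots of unity are integral of
absolute value `1` under every embedding). [claim: Mochizuki2012, status: disputed] -/
theorem integralAtAllPlaces_iff_rootOfUnity {x : K} (hx : x ≠ 0) :
    IsIntegralAtAllPlaces K x ↔ ∃ n : ℕ, 0 < n ∧ x ^ n = 1 := by
  constructor
  · rintro ⟨hint, hle⟩
    obtain ⟨n, hn, h⟩ := NumberField.Embeddings.pow_eq_one_of_norm_le_one K ℂ hx hint hle
    exact ⟨n, hn, h⟩
  · rintro ⟨n, hn, h⟩
    refine ⟨?_, fun φ => ?_⟩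
    · exact IsIntegral.of_pow hn (by rw [h]; exact isIntegral_one)
    · have hφ : ‖φ x‖ ^ n = 1 := by rw [← norm_pow, ← map_pow, h, map_one, norm_one]
      rcases (pow_eq_one_iff_of_nonneg (norm_nonneg _) hn.ne').mp hφ with h1
      exact h1.le

variable {K}
variable {V : Type v} (Ψ : V → Set K)

/-- INTERFACE axiom for [IUTchIII] Proposition 3.10 (ii), p. 148: membership of an element of the
number field `(†𝕄⊛_MOD)_α` (≅ `F_mod`) in the local monoid `Ψ_{log(^{A,α}𝓕_v)}` (nonzero local integers,
Proposition 3.4 (i); via the localization homomorphism of Proposition 3.3 (i)) for EVERY `v ∈ 𝕍`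
amounts to being nonzero and integral at all places of the number field (`𝕍 ≃ 𝕍_mod`, [IUTchI] Def.
3.1 (e); archimedean "integers" = elements of absolute value `≤ 1`, Example 3.6 (ii)).
[claim: Mochizuki2012, status: disputed] -/
def LocalMonoidsDetectIntegrality : Prop :=
  ∀ x : K, (∀ v, x ∈ Ψ v) ↔ (x ≠ 0 ∧ IsIntegralAtAllPlaces K x)

/-- **[IUTchIII] Proposition 3.10 (ii) "(Non-interference with Local Integers)"**, first display,
p. 148: `(†𝕄⊛_MOD)_α ∩ Π_{v∈𝕍} Ψ_{log(^{A,α}𝓕_v)} = (†𝕄⊛μ_MOD)_α` "— where we write `(†𝕄⊛μ_MOD)_α ⊆ (†𝕄⊛_MOD)_α`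
for the [finite] subgroup of torsion elements, i.e., roots of unity". PROVED from the classical
fact under the interface axiom `LocalMonoidsDetectIntegrality`.
[claim: Mochizuki2012, status: disputed] -/
theorem Prop310ii_nonInterference (hΨ : LocalMonoidsDetectIntegrality Ψ) :
    {x : K | ∀ v, x ∈ Ψ v} = {x : K | ∃ n : ℕ, 0 < n ∧ x ^ n = 1} := by
  ext x
  simp only [Set.mem_setOf_eq]
  rw [hΨ x]
  constructor
  · rintro ⟨hx0, hint⟩
    exact (integralAtAllPlaces_iff_rootOfUnity K hx0).mp hint
  · rintro ⟨n, hn, h⟩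
    have hx0 : x ≠ 0 := by
      rintro rfl
      rw [zero_pow hn.ne'] at h
      exact zero_ne_one h
    exact ⟨hx0, (integralAtAllPlaces_iff_rootOfUnity K hx0).mpr ⟨n, hn, h⟩⟩

/-- [IUTchIII] Proposition 3.10 (ii), second paragraph, pp. 148–149: the groups `(^{n,m}𝕄⊛_MOD)_j` of
nonzero elements act on the modules `𝓘^ℚ(^{S^±_{j+1}}𝓕(^{n,∘}𝔇_≻)_{𝕍_ℚ})` "via the totality of the various
pre-composites of Kummer isomorphisms with iterates … of the log-links", and "these actions are
mutually compatible up to [harmless!] 'identity indeterminacies' at an adjacent 'm', precisely as a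
consequence of the equality of the first display" — i.e. a global **log-Kummer correspondence**,
"invariant with respect to the translation symmetries … of the `n`-th column". Typed over abstract
data: the family of Kummer images of the groups `G m` in the automorphisms of the coric module is
the same after the shift `m ↦ m + 1`, and two images related by the log-link agree up to an element
acting as the identity ("identity indeterminacy"). [claim: Mochizuki2012, status: disputed] -/
def Prop310ii_logKummer {X : Type w} (G : ℤ → Type w) [∀ m, Group (G m)]
    (act : ∀ m, G m →* Equiv.Perm X) (Rel : ∀ m, G m → G (m + 1) → Prop) : Prop :=
  (⋃ m, Set.range (act m)) = (⋃ m, Set.range (act (m + 1))) ∧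
    ∀ m (g : G m) (g' : G (m + 1)), Rel m g g' → act (m + 1) g' = act m g

end NonInterference

/-! ### Proposition 3.10 (i), (iii): vertically coric global objects and Kummer isomorphisms -/

section Coric

variable (lstar : ℕ)

/-- OUTPUT SIGNATURE of [IUTchIII] Proposition 3.10 (i) "(Vertically Coric Global LGP-,
lgp-Frobenioids and Associated Kummer Theory)", pp. 147–148, for one column `n` and the labels
`j ∈ 𝔽_l^⋇`: vertically coric number fields `𝕄⊛_mod(^{n,∘}𝓗𝓣^𝒟)_j = 𝕄⊛_MOD(^{n,∘}𝓗𝓣^𝒟)_j` (with their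
multiplicative groups `𝕄⊛_mod(…)_j = 𝕄⊛_MOD(…)_j` of nonzero elements), Frobenioids
`𝓕⊛_mod(…)_j ≅ 𝓕⊛_𝔪𝔬𝔡(…)_j ≅ 𝓕⊛_MOD(…)_j`, `𝓕^⊩`-prime-strips `𝔉^⊩(…)_gau ≅ 𝔉^⊩(…)_LGP ≅ 𝔉^⊩(…)_lgp`, and, for
each `m ∈ ℤ`, "Kummer isomorphisms of fields, monoids, Frobenioids, and `𝓕^⊩`-prime-strips" from the
Frobenius-like objects at `(n,m)` to the coric ones, "compatible with the various equalities,
natural inclusions, and natural isomorphisms". Abstract parameters: `Frd`, `Strip` with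
isomorphism types `IsoF`, `IsoS`. [claim: Mochizuki2012, status: disputed] -/
structure VerticallyCoricGlobalData (Frd : Type u) (IsoF : Frd → Frd → Type w) (Strip : Type u)
    (IsoS : Strip → Strip → Type w) where
  /-- the vertically coric number field `𝕄⊛_mod(^{n,∘}𝓗𝓣^𝒟)_j = 𝕄⊛_MOD(^{n,∘}𝓗𝓣^𝒟)_j` -/
  Mcoric : Fin lstar → Type u
  /-- it is a field -/
  [instField : ∀ j, Field (Mcoric j)]
  /-- the Frobenius-like number fields `(^{n,m}𝕄⊛_mod)_j`, `m ∈ ℤ` -/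
  Mfrob : ℤ → Fin lstar → Type u
  /-- they are fields -/
  [instFieldFrob : ∀ m j, Field (Mfrob m j)]
  /-- Kummer isomorphisms of fields `(^{n,m}𝕄⊛_mod)_j ≅ 𝕄⊛_mod(^{n,∘}𝓗𝓣^𝒟)_j` -/
  kummerField : ∀ m j, Mfrob m j ≃+* Mcoric j
  /-- coric Frobenioids `𝓕⊛_mod(…)_j`, `𝓕⊛_𝔪𝔬𝔡(…)_j`, `𝓕⊛_MOD(…)_j` -/
  Fmod : Fin lstar → Frd
  /-- `𝓕⊛_𝔪𝔬𝔡(^{n,∘}𝓗𝓣^𝒟)_j` -/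
  Ffrak : Fin lstar → Frd
  /-- `𝓕⊛_MOD(^{n,∘}𝓗𝓣^𝒟)_j` -/
  FMOD : Fin lstar → Frd
  /-- natural isomorphisms `𝓕⊛_mod ≅ 𝓕⊛_𝔪𝔬𝔡 ≅ 𝓕⊛_MOD` -/
  isoModFrak : ∀ j, IsoF (Fmod j) (Ffrak j)
  /-- `𝓕⊛_𝔪𝔬𝔡 ≅ 𝓕⊛_MOD` -/
  isoFrakMOD : ∀ j, IsoF (Ffrak j) (FMOD j)
  /-- Frobenius-like Frobenioids `(^{n,m}𝓕⊛_MOD)_j` etc. and their Kummer isomorphisms -/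
  FMODfrob : ℤ → Fin lstar → Frd
  /-- Kummer isomorphisms of Frobenioids `(^{n,m}𝓕⊛_MOD)_j ≅ 𝓕⊛_MOD(^{n,∘}𝓗𝓣^𝒟)_j` -/
  kummerFMOD : ∀ m j, IsoF (FMODfrob m j) (FMOD j)
  /-- coric strips `𝔉^⊩(^{n,∘}𝓗𝓣^𝒟)_gau ≅ 𝔉^⊩(…)_LGP ≅ 𝔉^⊩(…)_lgp` -/
  Sgau : Strip
  /-- `𝔉^⊩(^{n,∘}𝓗𝓣^𝒟)_LGP` -/
  SLGP : Strip
  /-- `𝔉^⊩(^{n,∘}𝓗𝓣^𝒟)_lgp` -/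
  Slgp : Strip
  /-- `𝔉^⊩(…)_gau ≅ 𝔉^⊩(…)_LGP` -/
  isoGauLGP : IsoS Sgau SLGP
  /-- `𝔉^⊩(…)_LGP ≅ 𝔉^⊩(…)_lgp` -/
  isoLGPlgp : IsoS SLGP Slgp
  /-- Frobenius-like strips `^{n,m}𝔉^⊩_LGP` and their Kummer isomorphisms to `𝔉^⊩(^{n,∘}𝓗𝓣^𝒟)_LGP` -/
  SLGPfrob : ℤ → Strip
  /-- Kummer isomorphisms of strips -/
  kummerSLGP : ∀ m, IsoS (SLGPfrob m) SLGP

/-- [IUTchIII] Proposition 3.10 (iii) "(Frobenioid-theoretic log-Kummer Correspondences)", p. 149: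
the Kummer isomorphisms induce "isomorphisms of Frobenioids `(^{n,m}𝓕⊛_MOD)_α ≅ 𝓕⊛_MOD(^{n,∘}𝓗𝓣^𝒟)_α`,
`(^{n,m}𝓕⊛ℝ_MOD)_α ≅ 𝓕⊛ℝ_MOD(^{n,∘}𝓗𝓣^𝒟)_α` that are mutually compatible, as `m` varies over the elements of
`ℤ`, with the log-links", and "isomorphisms of associated `𝓕^{⊩⊥}`-prime-strips
`^{n,m}𝔉^{⊩⊥}_LGP ≅ 𝔉^{⊩⊥}(^{n,∘}𝓗𝓣^𝒟)_LGP` that are mutually compatible … with the log-links". Typed over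
abstract data: on the realified/value-group level the log-link `(n,m) → (n,m+1)` induces a map
`lg m` between the Frobenius-like objects, and compatibility says the Kummer isomorphisms
intertwine it with the identity of the coric object. [claim: Mochizuki2012, status: disputed] -/
def Prop310iii_compatible {C : Type u} (Ffrob : ℤ → Type u) (kum : ∀ m, Ffrob m ≃ C)
    (lg : ∀ m, Ffrob m → Ffrob (m + 1)) : Prop :=
  ∀ m (x : Ffrob m), kum (m + 1) (lg m x) = kum m x

end Coric

/-! ### Remarks 3.10.1, 3.10.2 -/

section Remarks

/-- [IUTchIII] Remark 3.10.1 (i), pp. 149–150: the log-Kummer correspondence induces Frobenioid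
isomorphisms for `𝓕⊛_MOD` "precisely because the construction of '`(†𝓕⊛_MOD)_α`' only involves the group
'`(†𝕄⊛_MOD)_α`', together with … subquotients of its perfection"; "By contrast, the construction of
'`(†𝓕⊛_𝔪𝔬𝔡)_α`' also involves the local monoids … subject to … 'upper semi-compatibility', i.e., …
one-sided inclusions … In particular, one cannot construct log-link-compatible isomorphisms of
Frobenioids for '`(†𝓕⊛_𝔪𝔬𝔡)_α`' as in the first display of Proposition 3.10, (iii)." Typed: the
non-existence of a log-link-compatible family of identifications for the `𝔪𝔬𝔡`-version (abstract
`Ffrak`, `lg`). [claim: Mochizuki2012, status: disputed] -/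
def Remark3101i_noCompatibleIso {C : Type u} (Ffrak : ℤ → Type u)
    (lg : ∀ m, Ffrak m → Ffrak (m + 1)) : Prop :=
  ¬ ∃ kum : ∀ m, Ffrak m ≃ C, Prop310iii_compatible Ffrak kum lg

/-- [IUTchIII] Remark 3.10.1 (ii), p. 150: "the mutual compatibility of the isomorphisms
`^{n,m}𝔉^{⊩⊥}_LGP ≅ 𝔉^{⊩⊥}(^{n,∘}𝓗𝓣^𝒟)_LGP` … asserts, in effect, that such Kummer-detachment indeterminacies do
not arise. This is precisely the reason why we wish to work with the LGP-, as opposed to the lgp-,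
Gaussian log-theta lattice"; but "the essentially multiplicative nature of '`𝓕⊛_MOD`' … makes it
ill-suited to the task of computing the étale-transport indeterminacies". Typed: "no
Kummer-detachment indeterminacy" = the compatible Kummer family is unique (any two compatible
families agree). [claim: Mochizuki2012, status: disputed] -/
def Remark3101ii_noKummerDetachmentIndeterminacy {C : Type u} (Ffrob : ℤ → Type u)
    (lg : ∀ m, Ffrob m → Ffrob (m + 1)) : Prop :=
  ∀ kum kum' : ∀ m, Ffrob m ≃ C,
    Prop310iii_compatible Ffrob kum lg → Prop310iii_compatible Ffrob kum' lg → kum = kum'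

/-- [IUTchIII] Remark 3.10.1 (iii), p. 150: although the local modules of `𝓕⊛_𝔪𝔬𝔡` suffer "distortions"
from upper semi-compatibility and from the holomorphic/mono-analytic discrepancy, "one may
nevertheless compute — i.e., … 'estimate' — the global arithmetic degrees of objects of '`𝓕⊛_𝔪𝔬𝔡`' by
computing log-volumes …, which are bi-coric, i.e., coric with respect to both the Θ^{×μ}_{LGP}-links
… and the log-links"; (iv), p. 151 and Fig. 3.2: "`𝓕⊛_MOD`/LGP-structures: biased toward
multiplicative structures, … precise log-Kummer correspondence, rigid, but not suited to explicit
computation" versus "`𝓕⊛_𝔪𝔬𝔡`/lgp-structures: biased toward additive structures, … 'upper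
semi-compatible' log-Kummer correspondence, subject to substantial distortion, but suited to
explicit estimates"; the isomorphisms `𝓕⊛_𝔪𝔬𝔡 ≅ 𝓕⊛_MOD`, `𝔉^⊩_LGP ≅ 𝔉^⊩_lgp` relate the two "by means of the
global ring structure of the number field". Typed ((iii) only): an ESTIMATE of degrees by a bi-coric
log-volume — the degree of an object is bounded above by the log-volume of any region containing
its region (abstract `deg`, `regionOf`, monotone bi-coric `vol`). [claim: Mochizuki2012, status: disputed] -/
def Remark3101iii_estimate {Obj R : Type u} [HasSubset R] (deg : Obj → ℝ) (regionOf : Obj → R)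
    (vol : R → ℝ) : Prop :=
  ∀ (J : Obj) (S : R), regionOf J ⊆ S → deg J ≤ vol S

/-- [IUTchIII] Remark 3.10.2, pp. 151–152: in the `2 × 4` commutative diagram of
`𝓕^{⊩▶×μ}`-prime-strips (upper row `𝔉^{⊩▶×μ}(^{n,∘})_env ≅ 𝔉(^{n,∘})_gau ≅ 𝔉(^{n,∘})_LGP ≅ 𝔉(^{n,∘})_lgp`, lower
row `^{n,m}𝔉^{⊩▶×μ}_env ≅ ^{n,m}𝔉_gau ≅ ^{n,m}𝔉_LGP ≅ ^{n,m}𝔉_lgp`, verticals the Kummer isomorphisms), "each of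
these lower horizontal arrows may be constructed by conjugating the corresponding upper horizontal
arrow by the relevant Kummer isomorphisms, i.e., by the vertical arrows" — PROVED as the formal
statement: defining the lower arrow as `κ'⁻¹ ∘ u ∘ κ` makes the square commute, and it is the unique
such arrow. [claim: Mochizuki2012, status: disputed] -/
theorem Remark3102_conjugate {A B A' B' : Type u} (κ : A' ≃ A) (κ' : B' ≃ B) (u : A ≃ B) :
    (∀ x, κ' ((κ.trans (u.trans κ'.symm)) x) = u (κ x)) ∧
      ∀ l : A' ≃ B', (∀ x, κ' (l x) = u (κ x)) → l = κ.trans (u.trans κ'.symm) := by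
  refine ⟨fun x => by simp, fun l hl => ?_⟩
  ext x
  apply κ'.injective
  simpa using hl x

end Remarks

/-! ### Remark 3.10.1 (ii) — corrected typing (appended; finding of abc-iut-L6-t5, INBOX 19:31:51Z) -/

section Remark3101iiCorrected

/-- [IUTchIII] Remark 3.10.1 (ii), p. 150 — CORRECTED typed reading of "such Kummer-detachment
indeterminacies do not arise". The earlier `Remark3101ii_noKummerDetachmentIndeterminacy` (any two
log-link-compatible Kummer families are EQUAL; with `C` implicit and undetermined by the explicit
arguments) is REFUTED in the abstract setting (abc-iut-L6-t5, `not_Remark3101ii_of_nontrivial_perm`: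
composing a compatible family with a nontrivial permutation of `C` gives another compatible family) — a
recorded mis-typing, not a discharge target. What the abstract setting supports, and what the text's
"precise log-Kummer correspondence … rigid" (Fig. 3.2) amounts to at this level, is: a compatible family
of Kummer identifications is DETERMINED BY ANY ONE OF ITS MEMBERS (no further indeterminacy propagates
along the column). Typed with `C` explicit; PROVED below in both directions along the column (upward
when the log-link maps `lg m` are surjective). [claim: Mochizuki2012, status: disputed] -/
def Remark3101ii_determinedByOneMember (C : Type u) (Ffrob : ℤ → Type u)
    (lg : ∀ m, Ffrob m → Ffrob (m + 1)) : Prop :=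
  ∀ kum kum' : ∀ m, Ffrob m ≃ C,
    Prop310iii_compatible Ffrob kum lg → Prop310iii_compatible Ffrob kum' lg →
      ∀ m, (kum m = kum' m ↔ kum (m + 1) = kum' (m + 1))

/-- Downward step (Rmk. 3.10.1 (ii), p. 150): two compatible Kummer families that agree at `m + 1` agree
at `m` — PROVED (no hypothesis on the log-link maps). [claim: Mochizuki2012, status: disputed] -/
theorem kummer_eq_of_eq_succ {C : Type u} {Ffrob : ℤ → Type u} {lg : ∀ m, Ffrob m → Ffrob (m + 1)}
    {kum kum' : ∀ m, Ffrob m ≃ C} (hk : Prop310iii_compatible Ffrob kum lg)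
    (hk' : Prop310iii_compatible Ffrob kum' lg) (m : ℤ) (h : kum (m + 1) = kum' (m + 1)) :
    kum m = kum' m := by
  ext x
  rw [← hk m x, ← hk' m x, h]

/-- Upward step (Rmk. 3.10.1 (ii), p. 150): two compatible Kummer families that agree at `m` agree at
`m + 1`, provided the log-link map `lg m` is surjective (every element at `m + 1` is a log-image) —
PROVED. [claim: Mochizuki2012, status: disputed] -/
theorem kummer_eq_succ_of_eq {C : Type u} {Ffrob : ℤ → Type u} {lg : ∀ m, Ffrob m → Ffrob (m + 1)}
    (hlg : ∀ m, Function.Surjective (lg m)) {kum kum' : ∀ m, Ffrob m ≃ C}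
    (hk : Prop310iii_compatible Ffrob kum lg) (hk' : Prop310iii_compatible Ffrob kum' lg) (m : ℤ)
    (h : kum m = kum' m) : kum (m + 1) = kum' (m + 1) := by
  ext y
  obtain ⟨x, rfl⟩ := hlg m y
  rw [hk m x, hk' m x, h]

/-- `Remark3101ii_determinedByOneMember` HOLDS whenever the log-link maps are surjective — PROVED from the
two step lemmas. [claim: Mochizuki2012, status: disputed] -/
theorem Remark3101ii_determinedByOneMember_holds (C : Type u) (Ffrob : ℤ → Type u)
    (lg : ∀ m, Ffrob m → Ffrob (m + 1)) (hlg : ∀ m, Function.Surjective (lg m)) :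
    Remark3101ii_determinedByOneMember C Ffrob lg := by
  intro kum kum' hk hk' m
  exact ⟨kummer_eq_succ_of_eq hlg hk hk' m, kummer_eq_of_eq_succ hk hk' m⟩

end Remark3101iiCorrected

/-! ### Proposition 3.10 (ii) log-Kummer correspondence — corrected typing (appended; RQ7 T4-F1) -/

section LogKummerCorrected

/-- [IUTchIII] Proposition 3.10 (ii), pp. 148–149 — CORRECTED typing of the global log-Kummer
correspondence (RQ7 post-landing finding T4-F1, abc-iut-L6-t19, INBOX 2026-08-25T19:41:58Z: in the
earlier `Prop310ii_logKummer` the first conjunct `(⋃ m, range (act m)) = ⋃ m, range (act (m+1))` is TRUE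
for EVERY `ℤ`-indexed family — kernel witness `AuditL6t19.Prop310ii_logKummer_fst_trivial` — and so
carries none of the printed content; it is a recorded mis-typing). Printed content: the actions of the
groups `(^{n,m}𝕄⊛_MOD)_j` on the coric modules, taken "via the totality of the various pre-composites of
Kummer isomorphisms with iterates … of the log-links", are "mutually compatible … up to [harmless!]
'identity indeterminacies' at an adjacent 'm'" and the correspondence is "invariant with respect to the
translation symmetries [cf. Proposition 1.3, (iv)] of the `n`-th column". Typed PER INDEX: every
Frobenius-like copy has the SAME image in the automorphisms of the coric module (translation
invariance of the individual Kummer images), and log-link-related elements act identically. `Rel m`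
MUST be instantiated by THE log-link relation of [IUTchIII] Def. 1.1 / Prop. 1.2 between the copies at
`m` and `m+1` (abc-iut-L6-t3's `LogLink` decls; TODO-merge) — with a junk `Rel` the second clause is
vacuous by design of the interface, not a claim. [claim: Mochizuki2012, status: disputed] -/
def Prop310ii_logKummer' {X : Type w} (G : ℤ → Type w) [∀ m, Group (G m)]
    (act : ∀ m, G m →* Equiv.Perm X) (Rel : ∀ m, G m → G (m + 1) → Prop) : Prop :=
  (∀ m, Set.range (act m) = Set.range (act (m + 1))) ∧
    ∀ m (g : G m) (g' : G (m + 1)), Rel m g g' → act (m + 1) g' = act m g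

/-- The corrected statement implies the image clause at every pair of indices `m`, `m + k` (translation
invariance along the whole column) — PROVED by induction on `k`. [claim: Mochizuki2012, status: disputed] -/
theorem Prop310ii_logKummer'.range_eq_add {X : Type w} {G : ℤ → Type w} [∀ m, Group (G m)]
    {act : ∀ m, G m →* Equiv.Perm X} {Rel : ∀ m, G m → G (m + 1) → Prop}
    (h : Prop310ii_logKummer' G act Rel) (m : ℤ) (k : ℕ) :
    Set.range (act m) = Set.range (act (m + k)) := by
  induction k with
  | zero => rw [Nat.cast_zero, add_zero]
  | succ k ih => rw [ih, Nat.cast_succ, ← add_assoc]; exact h.1 (m + k)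

end LogKummerCorrected

/-! ### Remark 3.10.1 (ii) — the "determined by one member" reading is formally TRIVIAL; the
contentful reading is the LGP/lgp CONTRAST (appended v4; reviewer of p406708, 2026-08-25T20:5xZ) -/

section Remark3101iiContent

/-- Log-link compatibility FORCES the log-link maps to be bijections: from
`kum (m+1) (lg m x) = kum m x` with `kum m`, `kum (m+1)` bijections, `lg m = (kum (m+1))⁻¹ ∘ kum m` —
PROVED (reviewer of p406708, `lg_bijective_of_compatible`). Consequently the hypothesis `hlg` of
`Remark3101ii_determinedByOneMember_holds` is redundant. [claim: Mochizuki2012, status: disputed] -/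
theorem lg_bijective_of_compatible {C : Type u} {Ffrob : ℤ → Type u} {lg : ∀ m, Ffrob m → Ffrob (m + 1)}
    {kum : ∀ m, Ffrob m ≃ C} (hk : Prop310iii_compatible Ffrob kum lg) (m : ℤ) :
    Function.Bijective (lg m) := by
  have h : lg m = fun x => (kum (m + 1)).symm (kum m x) := by
    funext x
    apply (kum (m + 1)).injective
    rw [hk m x, Equiv.apply_symm_apply]
  rw [h]
  exact ((kum m).trans (kum (m + 1)).symm).bijective

/-- `Remark3101ii_determinedByOneMember C Ffrob lg` holds for EVERY `C`, `Ffrob`, `lg` — PROVED with no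
surjectivity hypothesis (it follows from compatibility, `lg_bijective_of_compatible`). RECORDED
CONSEQUENCE (reviewer of p406708): that Prop is FORMALLY TRIVIAL at the abstract level and is therefore
NOT a typing of the printed content of [IUTchIII] Rmk. 3.10.1 (ii) — see `Remark3101ii_contrast` for
the contentful reading; `Remark3101ii_determinedByOneMember` / `_holds` and the refuted
`Remark3101ii_noKummerDetachmentIndeterminacy` remain in the file as recorded mis-typings (append-only).
[claim: Mochizuki2012, status: disputed] -/
theorem Remark3101ii_determinedByOneMember_trivial (C : Type u) (Ffrob : ℤ → Type u)
    (lg : ∀ m, Ffrob m → Ffrob (m + 1)) : Remark3101ii_determinedByOneMember C Ffrob lg := by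
  intro kum kum' hk hk' m
  exact ⟨kummer_eq_succ_of_eq (fun m => (lg_bijective_of_compatible hk m).2) hk hk' m,
    kummer_eq_of_eq_succ hk hk' m⟩

/-- [IUTchIII] Remark 3.10.1 (ii), p. 150 — CONTENTFUL typed reading: "the mutual compatibility of the
isomorphisms `^{n,m}𝔉^{⊩⊥}_LGP ≅ 𝔉^{⊩⊥}(^{n,∘}𝓗𝓣^𝒟)_LGP` of the second display of Proposition 3.10, (iii),
asserts, in effect, that such Kummer-detachment indeterminacies do not arise. This is precisely the
reason why we wish to work with the LGP-, as opposed to the lgp-, Gaussian log-theta lattice" — i.e.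
the CONTRAST between the two columns of data: on the `MOD`/LGP side a log-link-compatible family of
Kummer identifications EXISTS (Prop. 3.10 (iii)), while on the `𝔪𝔬𝔡`/lgp side NO such family exists
(Rmk. 3.10.1 (i), `Remark3101i_noCompatibleIso`: "one cannot construct log-link-compatible
isomorphisms of Frobenioids for `(†𝓕⊛_𝔪𝔬𝔡)_α`"). Both conjuncts are claims about the respective
interface data (neither is formally true or false at the abstract level).
[claim: Mochizuki2012, status: disputed] -/
def Remark3101ii_contrast (CMOD Cfrak : Type u) (FMOD Ffrak : ℤ → Type u)
    (lgMOD : ∀ m, FMOD m → FMOD (m + 1)) (lgfrak : ∀ m, Ffrak m → Ffrak (m + 1)) : Prop :=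
  (∃ kum : ∀ m, FMOD m ≃ CMOD, Prop310iii_compatible FMOD kum lgMOD) ∧
    Remark3101i_noCompatibleIso (C := Cfrak) Ffrak lgfrak

/-- Under `Remark3101ii_contrast`, the lgp-side log-link maps cannot all be bijections "compatibly":
more precisely, if SOME family of bijections `Ffrak m ≃ Cfrak` were log-link compatible the second
conjunct would fail — a reformulation making explicit that the obstruction on the `𝔪𝔬𝔡` side is the
non-existence of ANY compatible identification (PROVED, definitional). [claim: Mochizuki2012, status: disputed] -/
theorem Remark3101ii_contrast.no_frak_family {CMOD Cfrak : Type u} {FMOD Ffrak : ℤ → Type u}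
    {lgMOD : ∀ m, FMOD m → FMOD (m + 1)} {lgfrak : ∀ m, Ffrak m → Ffrak (m + 1)}
    (h : Remark3101ii_contrast CMOD Cfrak FMOD Ffrak lgMOD lgfrak)
    (kum : ∀ m, Ffrak m ≃ Cfrak) : ¬ Prop310iii_compatible Ffrak kum lgfrak :=
  fun hk => h.2 ⟨kum, hk⟩

end Remark3101iiContent

end Literature.IUT.LogThetaLattice
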